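import Literature.MathematicalPhysics.QuantumFieldTheory.Balaban1983to89.Beta.DriftRemainder
import Literature.MathematicalPhysics.QuantumFieldTheory.Balaban1983to89.Beta.LargeL
import Literature.MathematicalPhysics.QuantumFieldTheory.Balaban1983to89.B12Normalization
import Summits.QuantumFields.BalabanUV.Gaps.CapTailFloors

/-!
# Gaps / CapFreeLargeL — the CAP-FREE large-`L` road of row CAP BY NAME: a (D1)-type DRIFT of the one-loop coefficients at EVERY admissible
# block size, with ONE `L`-independent constant, is the β-lead's (AF-0-L) and hence a uniform floor with NO sign list at `L ≥ L₁`; the converse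
# fails; and the block size `L` of `B12.Thm2Printed C L` is a LOG-UNIT (cell pub-balaban-gaps, seat g1-p3 gen 4, CAP+tail charge; §§1–2 ADOPT
# g1-plan-2 gen 6's lens kernel `g1/skeletons/XreadDriftLogGrowth_plan2.lean` 059b11feb2cb1c48 (XREAD-PLAN2-CapTailFloors A-2, lens L-3 — cited by
# sha in BALABAN-GAPS row CAP since v0.4.10) with its witness `def shifted` written inline, §3 ADOPTS g1-plan-2 gen 5's `g1/skeletons/XreadThm2LogUnit_plan2.lean`
# 08e4298a740ddb2a; both byte-for-byte as declaration blocks up to the inlined witness, on the planner's standing «files nothing; p3 may adopt»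
# disposition; §4 is this seat's junction END)

HONEST FRAMING (cell rule, page 1 of everything): bookkeeping over hypothesis SHAPES; NOTHING of Bałaban's (1.22) is asserted; [Balaban1987RG1]
Thm 2 is UNPROVED IN PRINT; the drift `Beta.Drift.OneLoopDrift` ((D1) currency, row an1∕an2∕g1-p1), the log-growth law `Beta.LargeL.LogGrowthLower(On)`
((AF-0-L), β-lead BETA-SPEC §8.6) and the every-slope remainder are BINDERS — OPEN for Bałaban's split; the threshold `L₁(c, 2A, b₀) =
max 2 ⌈exp((2A + 2b₀)∕c)⌉` is a NUMBER NOBODY HAS (no drift constant `A` is known); 0 coefficients certified; 0∕6 binders discharged; NOT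
`BetaPertH`, NOT the continuum limit, NOT Clay.  HONEST DEPENDENCY (b2b cell, verbatim): «continuum YM on T⁴ ⇐ BetaPertH ∧ nine spine estimates
(0/9 proved); BetaPertH ⇐ (D1) ∧ (D4) ∧ CAP+tail; G-an2-4 gates asym, D1 and NE2/3/4.»

CONTENT.
§1 (plan-2 L-3) `ge_of_drift` ∕ `logGrowthLowerOn_of_drift` ∕ `logGrowthLower_of_drift` ∕ `logGrowth_of_drift`: a drift `OneLoopDrift (c·log L) A (β0 L)`
   at EVERY admissible `L` with a COMMON constant `A` is (AF-0-L) `LogGrowthLowerOn Adm β0 c (2A)` — two lines over the tree's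
   `Beta.DriftRemainder.abs_beta0_sub_le_of_drift`; hence the UNIFORM floor `2b₀ ≤ β⁰_{k+1}(L)` for ALL `k` at every admissible
   `L ≥ L₁(c, 2A, b₀)` (`floor_of_drift_uniform`, `af0_all_of_drift_uniform` via `Beta.LargeL.uniform_lower_on` ∕ `af0_all_on`): THE CAP SIGN LIST
   IS EMPTY THERE and no rate is used.
§2 (plan-2 L-3) the converse FAILS: the family `β0 L k := b·log L + 1` has the two-sided law `LogGrowth β0 b 1` yet at every `L` its partial sums
   drift off the line `b·log L·k` by `k` (`logGrowth_shifted`, `not_drift_shifted`, `logGrowth_not_implies_drift`) — the (D1) and (AF-0-L)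
   currencies are comparable in ONE direction only.
§3 (plan-2 gen 5) **`thm2Printed_iff_of_one_lt`**: for every construction `C` and all reals `L, L' > 1`, `B12.Thm2Printed C L ↔ B12.Thm2Printed C L'`
   — in the tree's typing of (0.31) the real `L` is the UNIT of the logarithm multiplying `(K − k)` with `β ≤ β'` existential, so it rescales
   away; the construction's block size lives INSIDE `C`.  Consequence for this seat's files: every `… (hL : 1 < L') : B12.Thm2Printed C' L'` END
   (`CapBlockTransferFloors`, `CapNegSocketOnePoint` §6, …) speaks about the CONSTRUCTION `C'` (e.g. through `hblock`), never about the real `L'`;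
   `thm2Printed_iff_exp` (unit `e`).
§4 (this seat) THE JUNCTION END **`thm2Printed_of_driftFamily_largeL`**: drifts at every admissible block size with one constant `A` (slope
   `c·log L`, `c > 0`) + `b₀ > 0` + an admissible `L ≥ L₁(c, 2A, b₀)` + the split of the `L`-construction + `EverySlope` + (C), (U) + forward
   generation ⟹ `B12.Thm2Printed C Lr` for every real `Lr > 1` — (0.31) with NO CAP and NO RATE, the price being `L`-UNIFORMITY of (D1)'s
   constants (row (D1)) and the threshold `L₁` (a number nobody has); `floor_pos_of_driftFamily` records the floor it runs on.
§5 (this seat) THE THRESHOLD AS A NUMBER: `L₁_le_iff` (`L₁ c A' b₀ ≤ L ↔ 2 ≤ L ∧ exp((A'+2b₀)∕c) ≤ L`), `L₁_le_of_budget`; `stepBal_two_thirteen_gt`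
   (`0.94 < stepBal 2 13`); **`L₁_le_thirteen_of_budget`**: with the drift slope = the tree's printed SU(2) one-loop step `stepBal 2 L` ((0.20) p. 256),
   `2A + 2b₀ ≤ 0.94 ⟹ L₁ ≤ 13` — the family road applies AT THE SMALLEST PRINTED BLOCK SIZE if row (D1) delivers an L-uniform drift
   constant `A ≤ 0.47 − b₀` (Bałaban's units); `thm2Printed_thirteen_of_driftFamily` (end to end at L = 13).  Nobody has any `A` today.
§6 (g1-plan-2 GEN 12 R-5 ∕ X-75, adopted in substance) ONE CONSTRUCTION SUFFICES and the budget is sharp: **`thm2Printed_of_drift_oneL`** (a drift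
   `OneLoopDrift b A β⁰` of ONE construction's coefficients with `2A < b` ⟹ (0.31), no list ∕ rate ∕ family ∕ L-uniformity — the one-shot
   threshold road needed `8A ≤ b`), `drift_allows_nonpos` (if `b ≤ 2A` the drift allows `β⁰₃ ≤ 0`: the budget `A < b∕2` is exact),
   **`thm2Printed_thirteen_of_drift_oneL`** (L = 13, SU(2): ONE drift constant `A ≤ 0.47`, `b₀`-free).
All [folklore]; 0 sorry; 0 def; imports tree files only; restates nothing (`Beta.LargeL`, `Beta.DriftRemainder`, `CapSignsConstRoad` used by name).
-/

namespace Summit.QuantumFields.BalabanUV.Gaps.CapFreeLargeL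

open Literature.MathematicalPhysics.QuantumFieldTheory.Balaban1983to89
open Literature.MathematicalPhysics.QuantumFieldTheory.Balaban1983to89.FlowStep
open Literature.MathematicalPhysics.QuantumFieldTheory.Balaban1983to89.DagBinding
open Literature.MathematicalPhysics.QuantumFieldTheory.Balaban1983to89.Beta.Drift (OneLoopDrift)
open Literature.MathematicalPhysics.QuantumFieldTheory.Balaban1983to89.Beta.DriftRemainder (abs_beta0_sub_le_of_drift)
open Literature.MathematicalPhysics.QuantumFieldTheory.Balaban1983to89.Beta.LargeL
open Summit.QuantumFields.BalabanUV.Gaps.CapSignsConstRoad (EverySlope thm2Printed_of_beta0Floor_everySlope)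

noncomputable section

/-! ## §1 (plan-2 L-3) Drift per `L` with a common constant ⟹ (AF-0-L) ⟹ uniform floor, no CAP -/

/-- Pointwise lower bound from a drift: `b − 2A ≤ β0 k` (the tree's `abs_beta0_sub_le_of_drift`, lower half). [folklore] -/
theorem ge_of_drift {b A : ℝ} {β0 : ℕ → ℝ} (h : OneLoopDrift b A β0) (k : ℕ) : b - 2 * A ≤ β0 k := by
  have := (abs_le.mp (abs_beta0_sub_le_of_drift h k)).1
  linarith

/-- **DRIFT at every admissible `L` with slope `c·log L` and a COMMON constant `A` ⟹ (AF-0-L) on `Adm` with constant `2A`.** [folklore] -/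
theorem logGrowthLowerOn_of_drift {Adm : ℕ → Prop} {β0 : ℕ → ℕ → ℝ} {c A : ℝ}
    (h : ∀ L : ℕ, Adm L → OneLoopDrift (c * Real.log L) A (β0 L)) :
    LogGrowthLowerOn Adm β0 c (2 * A) := fun L hAdm _ k => ge_of_drift (h L hAdm) k

/-- Unrestricted version (`Adm := (2 ≤ ·)`). [folklore] -/
theorem logGrowthLower_of_drift {β0 : ℕ → ℕ → ℝ} {c A : ℝ}
    (h : ∀ L : ℕ, 2 ≤ L → OneLoopDrift (c * Real.log L) A (β0 L)) :
    LogGrowthLower β0 c (2 * A) := fun L hL k => ge_of_drift (h L hL) k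

/-- Two-sided: drift per `L` with a common constant ⟹ the two-sided law `LogGrowth β0 c (2A)`. [folklore] -/
theorem logGrowth_of_drift {β0 : ℕ → ℕ → ℝ} {c A : ℝ}
    (h : ∀ L : ℕ, 2 ≤ L → OneLoopDrift (c * Real.log L) A (β0 L)) :
    LogGrowth β0 c (2 * A) := fun L hL k => abs_beta0_sub_le_of_drift (h L hL) k

/-- Hence the UNIFORM floor `2b₀ ≤ β⁰_{k+1}(L)` for every `k` at every admissible `L ≥ L₁(c, 2A, b₀)` — the CAP list is empty, no rate is used
(`Beta.LargeL.uniform_lower_on`). [folklore] -/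
theorem floor_of_drift_uniform {Adm : ℕ → Prop} {β0 : ℕ → ℕ → ℝ} {c A : ℝ} (hc : 0 < c)
    (h : ∀ L : ℕ, Adm L → OneLoopDrift (c * Real.log L) A (β0 L)) (b₀ : ℝ) {L : ℕ} (hAdm : Adm L)
    (hL : L₁ c (2 * A) b₀ ≤ L) : ∀ k, 2 * b₀ ≤ β0 L k :=
  uniform_lower_on (logGrowthLowerOn_of_drift h) hc b₀ hAdm hL

/-- … and on the split of the construction with that blocking factor: (AF-0) at ALL scales (`Beta.LargeL.af0_all_on`), the input of
`CapTailFloors.thm2Printed_of_logGrowth_everySlope` ∕ `Beta.LargeL.thm2Printed_on`. [folklore] -/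
theorem af0_all_of_drift_uniform {Adm : ℕ → Prop} {β0 : ℕ → ℕ → ℝ} {c A : ℝ} (hc : 0 < c)
    (h : ∀ L : ℕ, Adm L → OneLoopDrift (c * Real.log L) A (β0 L)) {b₀ : ℝ} {L : ℕ} (hAdm : Adm L)
    (hL : L₁ c (2 * A) b₀ ≤ L) {β : HBeta} (S : B12Beta.OneLoopSplit β) (hS : ∀ k, S.β0 k = β0 L k) :
    ∀ k, 2 * b₀ ≤ S.β0 k :=
  af0_all_on S (logGrowthLowerOn_of_drift h) hc hAdm hL hS

/-! ## §2 (plan-2 L-3) The converse fails: log-growth at slope `b` does not give a drift at slope `b·log L` -/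

/-- The family `β0 L k := b·log L + 1` (every coefficient one unit above the line) has the two-sided law `LogGrowth β0 b 1`. [folklore] -/
theorem logGrowth_shifted (b : ℝ) : LogGrowth (fun (L : ℕ) (_ : ℕ) => b * Real.log L + 1) b 1 := by
  intro L _ k
  simp

/-- At every `L` the partial sums of that family drift off the line `b·log L·k` by exactly `k`: no drift constant works. [folklore] -/
theorem not_drift_shifted (b : ℝ) (L : ℕ) (A : ℝ) : ¬ OneLoopDrift (b * Real.log L) A (fun _ : ℕ => b * Real.log L + 1) := by
  intro h
  obtain ⟨n, hn⟩ := exists_nat_gt A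
  have hk := h n
  have hsum : ∑ j ∈ Finset.range n, (fun _ : ℕ => b * Real.log L + 1) j - b * Real.log L * n = n := by
    simp [Finset.sum_const, Finset.card_range]
    ring
  rw [hsum, abs_of_nonneg (Nat.cast_nonneg n)] at hk
  linarith

/-- So (AF-0-L) two-sided ⇏ (D1)-type drift at the matching slope: the two currencies are comparable in ONE direction only (§1). [folklore] -/
theorem logGrowth_not_implies_drift :
    ¬ (∀ (β0 : ℕ → ℕ → ℝ) (b A : ℝ), LogGrowth β0 b A → ∀ L : ℕ, 2 ≤ L → ∃ A', OneLoopDrift (b * Real.log L) A' (β0 L)) := by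
  intro H
  obtain ⟨A', hA'⟩ := H (fun (L : ℕ) (_ : ℕ) => 1 * Real.log L + 1) 1 1 (logGrowth_shifted 1) 2 le_rfl
  exact not_drift_shifted 1 2 A' hA'

/-! ## §3 (plan-2 gen 5) `B12.Thm2Printed C L` is LOG-UNIT INVARIANT in the real `L` -/

/-- Rescaling the (0.31) constants `β ↦ β·(log L ∕ log L')` moves Theorem 2 as typed from unit `L` to unit `L'` (`L, L' > 1`).
[cite: Balaban1987RG1, Thm 2 (0.31) p.259] -/
theorem thm2Printed_imp_of_one_lt (C : B12.Construction) {L L' : ℝ} (hL : 1 < L) (hL' : 1 < L')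
    (h : B12.Thm2Printed C L) : B12.Thm2Printed C L' := by
  intro m
  obtain ⟨γ₂, hγ₂, h1⟩ := h m
  refine ⟨γ₂, hγ₂, fun γ hγ hγle => ?_⟩
  obtain ⟨gstar, hgstar, h2⟩ := h1 γ hγ hγle
  refine ⟨gstar, hgstar, fun g hg hgle => ?_⟩
  obtain ⟨β, β', hβ, hββ', h3⟩ := h2 g hg hgle
  have hlogL : 0 < Real.log L := Real.log_pos hL
  have hlogL' : 0 < Real.log L' := Real.log_pos hL'
  have hρpos : 0 < Real.log L / Real.log L' := div_pos hlogL hlogL'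
  have hkey : ∀ x y : ℝ, x * (y * Real.log L) = x * (Real.log L / Real.log L') * (y * Real.log L') := by
    intro x y
    field_simp
  refine ⟨β * (Real.log L / Real.log L'), β' * (Real.log L / Real.log L'), mul_pos hβ hρpos,
    mul_le_mul_of_nonneg_right hββ' hρpos.le, fun K => ?_⟩
  obtain ⟨g0, hI, hK, h4⟩ := h3 K
  refine ⟨g0, hI, hK, fun k hk => ?_⟩
  obtain ⟨lo, hi⟩ := h4 k hk
  refine ⟨?_, ?_⟩
  · rw [← hkey]; exact lo
  · rw [← hkey]; exact hi

/-- **`B12.Thm2Printed C L ↔ B12.Thm2Printed C L'` for all reals `L, L' > 1`**: the `L` of (0.31) as typed is a log-unit; the block size of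
the construction lives inside `C` (its `RunParams ⟨K, m, g₀⟩` and its flow), so an END `… : B12.Thm2Printed C' L'` speaks about `C'` only.
[cite: Balaban1987RG1, Thm 2 (0.31) p.259] -/
theorem thm2Printed_iff_of_one_lt (C : B12.Construction) {L L' : ℝ} (hL : 1 < L) (hL' : 1 < L') :
    B12.Thm2Printed C L ↔ B12.Thm2Printed C L' :=
  ⟨thm2Printed_imp_of_one_lt C hL hL', thm2Printed_imp_of_one_lt C hL' hL⟩

/-- In particular (0.31) in unit `e` (natural-log running `β·(K − k)`) is the same proposition. [cite: Balaban1987RG1, Thm 2 (0.31) p.259] -/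
theorem thm2Printed_iff_exp (C : B12.Construction) {L : ℝ} (hL : 1 < L) :
    B12.Thm2Printed C L ↔ B12.Thm2Printed C (Real.exp 1) :=
  thm2Printed_iff_of_one_lt C hL (by have := Real.add_one_lt_exp (one_ne_zero); linarith)

/-! ## §4 (this seat) The junction END: (D1)-type drifts at every admissible block size ⟹ (0.31) with NO CAP and NO RATE at `L ≥ L₁` -/

variable {β : HBeta}

/-- The floor the large-`L` road runs on, recorded: drifts at every admissible `L` (slope `c·log L`, ONE constant `A`, `c > 0`), `b₀ > 0`, an
admissible `L ≥ L₁(c, 2A, b₀)` and the split `S` of the `L`-construction (`hS`) ⟹ the uniform positive floor `∃ f > 0, ∀ k, f ≤ β⁰_{k+1}` —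
the weakest CAP+tail currency of `CapSignsConstRoad` with the sign list EMPTY. [folklore] -/
theorem floor_pos_of_driftFamily {Adm : ℕ → Prop} {β0 : ℕ → ℕ → ℝ} {c A b₀ : ℝ} (hc : 0 < c) (hb₀ : 0 < b₀)
    (h : ∀ L : ℕ, Adm L → OneLoopDrift (c * Real.log L) A (β0 L)) {L : ℕ} (hAdm : Adm L) (hL : L₁ c (2 * A) b₀ ≤ L)
    (S : B12Beta.OneLoopSplit β) (hS : ∀ k, S.β0 k = β0 L k) : ∃ f : ℝ, 0 < f ∧ ∀ k, f ≤ S.β0 k :=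
  ⟨2 * b₀, by positivity, af0_all_of_drift_uniform hc h hAdm hL S hS⟩

/-- **[Balaban1987RG1] THEOREM 2 AS PRINTED ON THE CAP-FREE LARGE-`L` ROAD, from (D1)-type drifts** (forward generation; every real log-unit
`Lr > 1`): drifts `OneLoopDrift (c·log L) A (β0 L)` at EVERY admissible block size `L` with ONE constant `A` and `c > 0`, `b₀ > 0`, an admissible
`L ≥ L₁(c, 2A, b₀)`, the split `S` of that construction (`hS`), `EverySlope S γc`, (C) and (U) on `]0,γc]` ⟹ `B12.Thm2Printed C Lr` — NO sign
list, NO rate (`CapSignsConstRoad.thm2Printed_of_beta0Floor_everySlope` on the floor `2b₀` of §1).  Inputs BY NAME that no printed source supplies: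
the drift family with a common `A` (row (D1), L-uniform), the every-slope residue (row (D4)), (C); and the threshold `L₁` is a number nobody has.
[cite: Balaban1987RG1, Thm 2 p.259 with (0.31)] -/
theorem thm2Printed_of_driftFamily_largeL {Adm : ℕ → Prop} {β0 : ℕ → ℕ → ℝ} {c A b₀ : ℝ} (hc : 0 < c) (hb₀ : 0 < b₀)
    (h : ∀ L : ℕ, Adm L → OneLoopDrift (c * Real.log L) A (β0 L)) {L : ℕ} (hAdm : Adm L) (hL : L₁ c (2 * A) b₀ ≤ L)
    (S : B12Beta.OneLoopSplit β) (hS : ∀ k, S.β0 k = β0 L k) {γc β' : ℝ} (hrem : EverySlope S γc) (hcont : BetaContH γc β)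
    (hup : BetaUpperH β' γc β) {C : B12.Construction} (hgen : ForwardGenerated C β) {Lr : ℝ} (hLr : 1 < Lr) :
    B12.Thm2Printed C Lr :=
  thm2Printed_of_beta0Floor_everySlope hgen hLr S (by positivity : (0 : ℝ) < 2 * b₀) (af0_all_of_drift_uniform hc h hAdm hL S hS)
    hrem hcont hup

/-- By §3 the conclusion is ONE proposition whatever the log-unit: stated in unit `e`. [cite: Balaban1987RG1, Thm 2 p.259 with (0.31)] -/
theorem thm2Printed_exp_of_driftFamily_largeL {Adm : ℕ → Prop} {β0 : ℕ → ℕ → ℝ} {c A b₀ : ℝ} (hc : 0 < c) (hb₀ : 0 < b₀)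
    (h : ∀ L : ℕ, Adm L → OneLoopDrift (c * Real.log L) A (β0 L)) {L : ℕ} (hAdm : Adm L) (hL : L₁ c (2 * A) b₀ ≤ L)
    (S : B12Beta.OneLoopSplit β) (hS : ∀ k, S.β0 k = β0 L k) {γc β' : ℝ} (hrem : EverySlope S γc) (hcont : BetaContH γc β)
    (hup : BetaUpperH β' γc β) {C : B12.Construction} (hgen : ForwardGenerated C β) : B12.Thm2Printed C (Real.exp 1) :=
  thm2Printed_of_driftFamily_largeL hc hb₀ h hAdm hL S hS hrem hcont hup hgen
    (by have := Real.add_one_lt_exp (one_ne_zero); linarith)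

/-! ## §5 (this seat) The threshold `L₁` as a NUMBER: the drift-constant budget at a fixed block size -/

/-- The closed form of the β-lead's threshold: `L₁ c A' b₀ ≤ L ↔ 2 ≤ L ∧ exp((A' + 2b₀)∕c) ≤ L`
(`Beta.LargeL.L₁ c A' b₀ = max 2 ⌈exp((A' + 2b₀)∕c)⌉₊`). [folklore] -/
theorem L₁_le_iff {c A' b₀ : ℝ} {L : ℕ} : L₁ c A' b₀ ≤ L ↔ 2 ≤ L ∧ Real.exp ((A' + 2 * b₀) / c) ≤ (L : ℝ) := by
  unfold L₁
  rw [max_le_iff, Nat.ceil_le]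

/-- Budget form: `c > 0`, `2 ≤ L` and `A' + 2b₀ ≤ c·log L` ⟹ `L₁ c A' b₀ ≤ L`. [folklore] -/
theorem L₁_le_of_budget {c A' b₀ : ℝ} (hc : 0 < c) {L : ℕ} (hL : 2 ≤ L) (h : A' + 2 * b₀ ≤ c * Real.log L) :
    L₁ c A' b₀ ≤ L := by
  refine L₁_le_iff.mpr ⟨hL, ?_⟩
  have hLpos : (0 : ℝ) < (L : ℝ) := by exact_mod_cast (lt_of_lt_of_le (by norm_num : 0 < 2) hL)
  calc Real.exp ((A' + 2 * b₀) / c) ≤ Real.exp (Real.log L) :=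
        Real.exp_le_exp.mpr ((div_le_iff₀ hc).mpr (by rw [mul_comm (Real.log (L : ℝ)) c]; exact h))
    _ = L := Real.exp_log hLpos

/-- NUMBERS: the tree's printed one-loop step for SU(2) at the smallest printed block size exceeds `0.94`:
`0.94 < stepBal 2 13 = (11·2²∕(12π²))·log 13` (kernel bound via `π < 3.1416`, `log 2 > 0.6931471803`, `log(16∕13) ≤ 3∕13`; the companion
`CapTailSigns.threshold_two_thirteen_gt` has `0.7 < 3·stepBal 2 13∕4`). [cite: Balaban1987RG1, (0.20) p.256] -/
theorem stepBal_two_thirteen_gt : (0.94 : ℝ) < B12Normalization.stepBal 2 13 := by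
  rw [B12Normalization.stepBal_eq]
  have hπ := Real.pi_lt_d4
  have hπ0 := Real.pi_pos
  have hlog2 := Real.log_two_gt_d9
  have h16 : Real.log 16 = 4 * Real.log 2 := by
    rw [show (16 : ℝ) = 2 ^ 4 by norm_num, Real.log_pow]; norm_num
  have hdiv : Real.log (16 / 13) = Real.log 16 - Real.log 13 := Real.log_div (by norm_num) (by norm_num)
  have hle : Real.log (16 / 13) ≤ 16 / 13 - 1 := Real.log_le_sub_one_of_pos (by norm_num)
  have hlog13 : (2.5418 : ℝ) < Real.log 13 := by linarith
  have hπ2 : Real.pi ^ 2 < 9.86965056 := by nlinarith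
  have hcoef : (0.3715 : ℝ) < 11 * (2:ℝ) ^ 2 / (12 * Real.pi ^ 2) := by
    rw [lt_div_iff₀ (by positivity)]; nlinarith
  have hprod : (0.3715 : ℝ) * 2.5418 < 11 * (2:ℝ) ^ 2 / (12 * Real.pi ^ 2) * Real.log 13 := by
    have h0 : (0 : ℝ) < 11 * (2:ℝ) ^ 2 / (12 * Real.pi ^ 2) := by positivity
    nlinarith
  nlinarith

/-- **THE BUDGET AT THE SMALLEST PRINTED BLOCK SIZE, SU(2)**: with the drift slope taken as the tree's printed one-loop step
`B12Normalization.stepBal 2 L = c·log L`, `c = 11·2²∕(12π²)` ((0.20) p. 256), an L-UNIFORM drift constant `A` and floor target `b₀` with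
`2A + 2b₀ ≤ 0.94` give `L₁(c, 2A, b₀) ≤ 13` — the CAP-free large-`L` road of §4 applies at `L = 13` (and at every larger admissible block size).
So on the FAMILY road a sufficient number for row (D1) is an L-uniform drift constant `A ≤ 0.47 − b₀` (Bałaban's units, SU(2)); §6 removes
the family and `b₀` (ONE construction, `A ≤ 0.47`); nobody has any `A` today.
[cite: Balaban1987RG1, (0.20) p.256 and Thm 2 p.259] -/
theorem L₁_le_thirteen_of_budget {A b₀ : ℝ} (h : 2 * A + 2 * b₀ ≤ 0.94) :
    L₁ (11 * (2:ℝ) ^ 2 / (12 * Real.pi ^ 2)) (2 * A) b₀ ≤ 13 := by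
  refine L₁_le_of_budget (by positivity) (by norm_num) ?_
  have h13 := stepBal_two_thirteen_gt
  rw [B12Normalization.stepBal_eq] at h13
  push_cast
  linarith

/-- Hence, END TO END at the printed block size 13 (SU(2) slope): drifts `OneLoopDrift (stepBal 2 L) A (β0 L)` at every admissible `L`
with ONE constant `A`, `2A + 2b₀ ≤ 0.94`, `0 < b₀`, `Adm 13`, the split of the 13-construction, `EverySlope`, (C), (U), forward generation
⟹ `B12.Thm2Printed C Lr` — NO sign list, NO rate. [cite: Balaban1987RG1, (0.20) p.256 and Thm 2 p.259 with (0.31)] -/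
theorem thm2Printed_thirteen_of_driftFamily {Adm : ℕ → Prop} {β0 : ℕ → ℕ → ℝ} {A b₀ : ℝ} (hb₀ : 0 < b₀)
    (h : ∀ L : ℕ, Adm L → OneLoopDrift (B12Normalization.stepBal 2 L) A (β0 L)) (hbudget : 2 * A + 2 * b₀ ≤ 0.94)
    (hAdm : Adm 13) (S : B12Beta.OneLoopSplit β) (hS : ∀ k, S.β0 k = β0 13 k) {γc β' : ℝ} (hrem : EverySlope S γc)
    (hcont : BetaContH γc β) (hup : BetaUpperH β' γc β) {C : B12.Construction} (hgen : ForwardGenerated C β) {Lr : ℝ}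
    (hLr : 1 < Lr) : B12.Thm2Printed C Lr := by
  have h' : ∀ L : ℕ, Adm L → OneLoopDrift (11 * (2:ℝ) ^ 2 / (12 * Real.pi ^ 2) * Real.log L) A (β0 L) := fun L hL => by
    rw [← B12Normalization.stepBal_eq]; exact h L hL
  exact thm2Printed_of_driftFamily_largeL (by positivity) hb₀ h' hAdm (L₁_le_thirteen_of_budget hbudget) S hS hrem hcont hup hgen hLr

/-! ## §6 ONE construction suffices (g1-plan-2 GEN 12's R-5 ∕ X-75 kernel `XreadCapFreeOneL_plan2.v2` 5f6c287977b4845b, adopted in substance) -/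

/-- **THE DRIFT ROAD AT ONE BLOCK SIZE, CAP-FREE iff-sharp budget `2A < b`.**  A (D1)-type drift `OneLoopDrift b A β⁰` of the one-loop
coefficients of ONE construction (slope `b`, constant `A`) gives the pointwise floor `b − 2A ≤ β⁰_{k+1}` (`ge_of_drift`); so `2A < b` +
`EverySlope` + (C), (U) + forward generation ⟹ [I] Theorem 2 as printed for every real log-unit `Lr > 1` — NO sign list, NO rate, NO family of
block sizes, NO `L`-uniformity (plan-2 R-5: the family ∕ `L₁` framing of §§4–5 is sufficient, not necessary).  The tree's one-shot road
(`Beta.OneShotTelescope`, census R5) makes the CAP automatic at `8A ≤ b·log L` on the threshold road; the floor road needs only `2A < b`.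
[cite: Balaban1987RG1, Thm 2 p.259 with (0.31)] -/
theorem thm2Printed_of_drift_oneL (S : B12Beta.OneLoopSplit β) {b A : ℝ} (h : OneLoopDrift b A S.β0) (hA : 2 * A < b)
    {γc β' : ℝ} (hrem : EverySlope S γc) (hcont : BetaContH γc β) (hup : BetaUpperH β' γc β) {C : B12.Construction}
    (hgen : ForwardGenerated C β) {Lr : ℝ} (hLr : 1 < Lr) : B12.Thm2Printed C Lr :=
  thm2Printed_of_beta0Floor_everySlope hgen hLr S (by linarith : (0 : ℝ) < b - 2 * A) (fun k => ge_of_drift h k) hrem hcont hup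

/-- **SHARPNESS of `2A < b`**: if `b ≤ 2A` (and `0 ≤ A`) the drift ALLOWS a nonpositive coefficient — the sequence `b − A, b + 2A, b − 2A, b, b, …`
has partial sums within `A` of the line `b·k` and its third entry is `b − 2A ≤ 0`.  So on the drift road the CAP-free budget is exactly `A < b∕2`.
[folklore] -/
theorem drift_allows_nonpos {b A : ℝ} (hA0 : 0 ≤ A) (hbA : b ≤ 2 * A) :
    ∃ β0 : ℕ → ℝ, OneLoopDrift b A β0 ∧ β0 2 ≤ 0 := by
  set f : ℕ → ℝ := fun j => if j = 0 then b - A else if j = 1 then b + 2 * A else if j = 2 then b - 2 * A else b with hf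
  have hf0 : f 0 = b - A := by simp [hf]
  have hf1 : f 1 = b + 2 * A := by simp [hf]
  have hf2 : f 2 = b - 2 * A := by simp [hf]
  have hf3 : ∀ j, 3 ≤ j → f j = b := fun j hj => by
    have h0 : j ≠ 0 := by omega
    have h1 : j ≠ 1 := by omega
    have h2 : j ≠ 2 := by omega
    simp [hf, h0, h1, h2]
  -- partial sums: S₀ = 0, S₁ = b − A, S₂ = 2b + A, S_k = kb − A for k ≥ 3
  have hS : ∀ k, 3 ≤ k → ∑ j ∈ Finset.range k, f j = b * k - A := by
    intro k hk
    induction k with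
    | zero => exact absurd hk (by norm_num)
    | succ n ih =>
      rcases Nat.lt_or_ge n 3 with hn | hn
      · have h2 : n = 2 := by omega
        subst h2
        rw [Finset.sum_range_succ, Finset.sum_range_succ, Finset.sum_range_one, hf0, hf1, hf2]
        push_cast
        ring
      · rw [Finset.sum_range_succ, ih hn, hf3 n hn]
        push_cast
        ring
  refine ⟨f, fun k => ?_, by rw [hf2]; linarith⟩
  rcases Nat.lt_or_ge k 3 with hk | hk
  · interval_cases k
    · simp [hA0]
    · rw [Finset.sum_range_one, hf0]
      exact abs_le.mpr ⟨by push_cast; linarith, by push_cast; linarith⟩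
    · rw [Finset.sum_range_succ, Finset.sum_range_one, hf0, hf1]
      exact abs_le.mpr ⟨by push_cast; linarith, by push_cast; linarith⟩
  · rw [hS k hk]
    exact abs_le.mpr ⟨by linarith, by linarith⟩

/-- **AT THE SMALLEST PRINTED BLOCK SIZE, ONE CONSTRUCTION** (R-5's reading, `b₀`-free): a drift of the 13-construction's own one-loop coefficients
along the printed SU(2) step, `OneLoopDrift (stepBal 2 13) A β⁰` with `A ≤ 0.47` (`< stepBal 2 13 ∕ 2` by `stepBal_two_thirteen_gt`), +
`EverySlope` + (C), (U) + forward generation ⟹ `B12.Thm2Printed C Lr`.  The number row (D1) must deliver on this road: ONE drift constant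
`A ≤ 0.47` for the construction at L = 13 (Bałaban's units); at a larger admissible `L` the budget is `2A(L) < (11·2²∕(12π²))·log L` with `A(L)`
free to depend on `L`. [cite: Balaban1987RG1, (0.20) p.256 and Thm 2 p.259 with (0.31)] -/
theorem thm2Printed_thirteen_of_drift_oneL (S : B12Beta.OneLoopSplit β) {A : ℝ}
    (h : OneLoopDrift (B12Normalization.stepBal 2 13) A S.β0) (hA : A ≤ 0.47) {γc β' : ℝ} (hrem : EverySlope S γc)
    (hcont : BetaContH γc β) (hup : BetaUpperH β' γc β) {C : B12.Construction} (hgen : ForwardGenerated C β) {Lr : ℝ}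
    (hLr : 1 < Lr) : B12.Thm2Printed C Lr :=
  thm2Printed_of_drift_oneL S h (by have := stepBal_two_thirteen_gt; linarith) hrem hcont hup hgen hLr

end

end Summit.QuantumFields.BalabanUV.Gaps.CapFreeLargeL
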